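import Summits.ResolutionOfSingularities.ResolutionOfSingularities.Theorems.JacobianBudgetIsolatedJacobianDropSurfaceFormal
import Summits.ResolutionOfSingularities.ResolutionOfSingularities.Theorems.JacobianBudgetIsolatedJacobianDropCharTwo
import Summits.ResolutionOfSingularities.ResolutionOfSingularities.Theorems.JacobianBudgetIsolatedJacobianDropSingleStepN1
import Summits.ResolutionOfSingularities.ResolutionOfSingularities.Theorems.WildConesClassicalRegimesStubOrdPExitSurface
import Summits.ResolutionOfSingularities.ResolutionOfSingularities.Theorems.WildConesClassicalRegimesStubMuDropSurfaceOrdSucc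

/-!
# Crux `IsolatedJacobianDrop` (stmt-ResolutionOfSingularities-18946, route `JacobianBudget`) —
# the SURFACE budget `Δ₂(p) = p² − p − 1` for the dynamics, and the budget in the CLASSICAL REGIMES

Route-level consequences of the formal surface budget
(`Theorems/JacobianBudgetIsolatedJacobianDropSurfaceFormal.lean`, `SurfaceBudget.surface_budget_any`)
for the point-blow-up dynamics of the height-one atom `z ^ p = a(u₁, u₂)` named in
`Theorems/WildConesClassicalRegimesDefs.lean` (`clean`, `bl`, `dv`, `tr`, `step`, `ser`, `jac`, `Isol`,
`MultP`, `OrdP`, `mu`):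

* `singleStepDrop_twoVars` — **the one-step budget for surfaces, every prime `p`**: if a two-variable
  state `c` and its successor `step i τ c` are both isolated of multiplicity `p` (over any perfect field
  of characteristic `p`), then `μ(step i τ c) + Δ₂(p) ≤ μ(c)` with `Δ₂(p) = p² − p − 1` written out as the
  crux's `((p - 1) ^ 2 * (p + 1) + 1 - 2 * ((2 + 1) % 2)) / p` (`decrement_twoVars`). Dictionary: the
  state has cleaned order `≥ p + 1` (`WildCones.stub_ordPExitSurface`: order exactly `p` exits
  multiplicity `p`; `MuDropSurface.ser_mem_pow_succ`), `X_i ^ p · T = (ser c)∘Φ_{i,τ}` and the two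
  Jacobian ideals are the `pderiv`-gradient ideals of `ser c` and `T`
  (`MuDropCharTwoOrdP.X_pow_mul_serT_eq_subst`, `jac_eq_span_pderiv`, `jac_step_eq_span_pderiv`).
* `singleStepDrop_classical` — **the one-step budget in the classical regimes `n ≤ 2 ∨ p = 2`**
  (every `n`, decrement written out as the crux's `let Δ`): `n = 1` is the landed stub
  `stub_singleStepN1` (`Δ₁ = p`, `decrement_oneVar`), `n = 2` is `singleStepDrop_twoVars`, `p = 2` is
  `CharTwo.singleStepDrop_of_eq_two` (`Theorems/JacobianBudgetIsolatedJacobianDropCharTwo.lean`).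
  These are exactly the regimes of the sibling crux `WildCones.ClassicalRegimes`, where the Milnor number
  was shown to DROP; here the drop is QUANTIFIED by the crux's sharp constant. What remains of the budget
  crux after this file is the wild regime `p` odd, `n ≥ 3` (line `euler-noether`'s intersection theory:
  `stub_noExcess`, `stub_mixedNoether`, `stub_budgetOfEngines`).

Tightness in print/census: `Δ₂(3) = 5` and `Δ₂(5) = 19` are attained (item evidence DUAL-NUMERICS.md,
kit j022217: 93 transitions at slack `0`). BANK item of chain W4.1 (campaign res-hironaka, rung L,
slot W4.1), explicitly not summit progress. Everything here is OURS and elementary over landed lemmas;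
it replaces the role of no printed item and is NOT a statement of Hironaka's manuscript. Source of the
mechanism: Max Noether's formula, E. Casas-Alvero, *Singular Points of Plane Curves* (2000), Thm 3.3.1;
the `n = 2` budget in characteristic zero is van den Essen's (LNM 712, 1979). [folklore]
-/

noncomputable section

-- single-problem summit: the doubled namespace component `ResolutionOfSingularities` is forced
set_option linter.dupNamespace false

open scoped BigOperators Classical

open MvPowerSeries IsLocalRing

open Literature.AlgebraicGeometry.Resolution
open Literature.RingTheory.MvPowerSeries.Jets

open Summit.ResolutionOfSingularities.ResolutionOfSingularities.Theorems.WildCones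
  (clean bl ord dv tr step run ser pd jac Isol MultP OrdP mu stub_ordPExitSurface)
open Summit.ResolutionOfSingularities.ResolutionOfSingularities.Theorems.WildCones.MuDropCharTwoOrdP
  (X_pow_mul_serT_eq_subst jac_eq_span_pderiv jac_step_eq_span_pderiv)
open Summit.ResolutionOfSingularities.ResolutionOfSingularities.Theorems.WildCones.MuDropSurface
  (ser_mem_pow_succ)

namespace Summit.ResolutionOfSingularities.ResolutionOfSingularities.Theorems.JacobianBudget

/-! ## The decrements `Δ₁(p) = p` and `Δ₂(p) = p² − p − 1`, written out -/

/-- `Δ₁(p) = p`: the crux's decrement `((p - 1) ^ n * (p + 1) + 1 - 2 * ((n + 1) % 2)) / p` at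
`n = 1` (verbatim, `n` replaced by `1`). [folklore] -/
theorem decrement_oneVar {p : ℕ} (hp : 1 ≤ p) :
    ((p - 1) ^ 1 * (p + 1) + 1 - 2 * ((1 + 1) % 2)) / p = p := by
  obtain ⟨q, rfl⟩ := Nat.exists_eq_add_of_le hp
  have h1 : (1 + q - 1) ^ 1 * (1 + q + 1) + 1 - 2 * ((1 + 1) % 2) = (1 + q) * (1 + q) := by
    rw [show 1 + q - 1 = q by omega, pow_one, show (1 + 1) % 2 = 0 by decide, mul_zero, Nat.sub_zero]
    ring
  rw [h1, Nat.mul_div_cancel_left _ (by omega : 0 < 1 + q)]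

/-- `Δ₂(p) = p² − p − 1`: the crux's decrement at `n = 2` (verbatim, `n` replaced by `2`), for
`p ≥ 2`. [folklore] -/
theorem decrement_twoVars {p : ℕ} (hp : 2 ≤ p) :
    ((p - 1) ^ 2 * (p + 1) + 1 - 2 * ((2 + 1) % 2)) / p = p * p - p - 1 := by
  obtain ⟨q, rfl⟩ := Nat.exists_eq_add_of_le hp
  have h1 : (2 + q - 1) ^ 2 * (2 + q + 1) + 1 - 2 * ((2 + 1) % 2) = (2 + q) * (q * q + 3 * q + 1) := by
    rw [show 2 + q - 1 = q + 1 by omega, show (2 + 1) % 2 = 1 by decide, mul_one]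
    have e : (q + 1) ^ 2 * (2 + q + 1) + 1 = (2 + q) * (q * q + 3 * q + 1) + 2 := by ring
    omega
  have h2 : (2 + q) * (2 + q) - (2 + q) - 1 = q * q + 3 * q + 1 := by
    have e : (2 + q) * (2 + q) = (q * q + 3 * q + 1) + (2 + q) + 1 := by ring
    omega
  rw [h1, h2, Nat.mul_div_cancel_left _ (by omega : 0 < 2 + q)]

/-! ## The one-step budget for surfaces, every prime -/

/-- **THE SURFACE BUDGET for the dynamics (every prime `p`).** If a two-variable state `c` and its
successor `step i τ c` are both isolated of multiplicity `p`, then `μ(step i τ c) + Δ₂(p) ≤ μ(c)`,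
`Δ₂(p) = p² − p − 1` written out as in the crux. The state has cleaned order `≥ p + 1` (cleaned order
exactly `p` exits multiplicity `p`, `stub_ordPExitSurface`); the dictionary hands the formal pair
`(ser c, T)` to `SurfaceBudget.surface_budget_any`. [folklore] -/
theorem singleStepDrop_twoVars (p : ℕ) (hp : p.Prime) (κ : Type) [Field κ] [CharP κ p] [PerfectField κ]
    (c : (Fin 2 → ℕ) → κ) (i : Fin 2) (τ : Fin 2 → κ)
    (hI : Isol p 2 κ c) (hM : MultP p 2 κ c) (hI' : Isol p 2 κ (step p 2 κ i τ c))
    (hM' : MultP p 2 κ (step p 2 κ i τ c)) :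
    mu p 2 κ (step p 2 κ i τ c) + ((p - 1) ^ 2 * (p + 1) + 1 - 2 * ((2 + 1) % 2)) / p ≤ mu p 2 κ c := by
  -- cleaned order exactly `p` would exit multiplicity `p`
  have hO : ¬ OrdP p 2 κ c := fun hO => stub_ordPExitSurface p hp κ c i τ hM hO hM'
  have hord : ((p + 1 : ℕ) : ℕ∞) ≤ (ser p 2 κ c).order :=
    le_order_iff_mem_maximalIdeal_pow.mpr (ser_mem_pow_succ hM hO)
  -- the dictionary
  have hT := X_pow_mul_serT_eq_subst c i τ hM
  have hj := jac_eq_span_pderiv (p := p) c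
  have hj' := jac_step_eq_span_pderiv c i τ hM
  change Module.Finite κ (MvPowerSeries (Fin 2) κ ⧸ jac p 2 κ c) at hI
  change Module.Finite κ (MvPowerSeries (Fin 2) κ ⧸ jac p 2 κ (step p 2 κ i τ c)) at hI'
  change Module.finrank κ (MvPowerSeries (Fin 2) κ ⧸ jac p 2 κ (step p 2 κ i τ c)) + _ ≤
    Module.finrank κ (MvPowerSeries (Fin 2) κ ⧸ jac p 2 κ c)
  rw [hj] at hI ⊢
  rw [hj'] at hI' ⊢
  have hb := SurfaceBudget.surface_budget_any hp i τ hord hT hI hI'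
  rw [decrement_twoVars hp.two_le]
  have hp2 : 2 ≤ p := hp.two_le
  have h2p : 2 * p ≤ p * p := Nat.mul_le_mul_right p hp2
  omega

/-! ## The one-step budget in the classical regimes `n ≤ 2 ∨ p = 2` -/

/-- **THE ONE-STEP BUDGET IN THE CLASSICAL REGIMES** (`n ≤ 2 ∨ p = 2`; the binder shape of
`JacobianBudget.SingleStepDrop` with the regime hypothesis added and the decrement `Δ_n(p)` written out as
the crux's `let Δ`): `n = 1` by the landed stub `stub_singleStepN1`, `n = 2` by `singleStepDrop_twoVars`,
`p = 2` by `CharTwo.singleStepDrop_of_eq_two`. [folklore] -/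
theorem singleStepDrop_classical (p : ℕ) (hp : p.Prime) (n : ℕ) (hn : 0 < n) (hreg : n ≤ 2 ∨ p = 2)
    (κ : Type) [Field κ] [CharP κ p] [PerfectField κ]
    (c : (Fin n → ℕ) → κ) (i : Fin n) (τ : Fin n → κ)
    (hI : Isol p n κ c) (hM : MultP p n κ c) (hI' : Isol p n κ (step p n κ i τ c))
    (hM' : MultP p n κ (step p n κ i τ c)) :
    mu p n κ (step p n κ i τ c) + ((p - 1) ^ n * (p + 1) + 1 - 2 * ((n + 1) % 2)) / p ≤ mu p n κ c := by
  by_cases h2 : p = 2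
  · exact CharTwo.singleStepDrop_of_eq_two p h2 n κ c i τ hI hM hI' hM'
  · have hle : n ≤ 2 := hreg.resolve_right h2
    interval_cases n
    · rw [decrement_oneVar hp.one_le]
      exact stub_singleStepN1 p hp κ c i τ hI hM hI' hM'
    · exact singleStepDrop_twoVars p hp κ c i τ hI hM hI' hM'

end Summit.ResolutionOfSingularities.ResolutionOfSingularities.Theorems.JacobianBudget

end
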